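import Summits.Ventures.PackingBounds.Configurations.CL17Vectors

/-!
# Cohn–Li in dimension `18`, I: pattern vectors with a second axis

Framing: lottery ticket; floor = certified bounds/negative ranges. Venture `PackingBounds` (cell
`pub-packcert`, seat `pub-packcert-energy`).

Integer model of `ℝ^{4×4} × ℝ × ℝ` (Cohn–Li 2024, §4) inside `ℤ²⁴`, scaled by `6`: a vector `(x, t√2, s√6)` with
`x ∈ ℤ¹⁶` is stored as `(x₀, …, x₁₅, t, t, 2s, s, s, 0, 0, 0)`, so that the tree's integer inner product `ip` on
`ℤ²⁴` IS the inner product of `ℝ¹⁸` (`2tt'` from the doubled `√2`-axis, `(4+1+1)ss' = 6ss'` from the tripled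
`√6`-axis) and the configuration lies in the `18`-dimensional subspace
`{y₁₆ = y₁₇, y₁₈ = 2y₁₉ = 2y₂₀, y₂₁ = y₂₂ = y₂₃ = 0}`. The vectors are `qvec S f a e g = pvec S f a e + axis6 g`
(`pvec` from `CL17Vectors.lean`, `axis6 g = (0¹⁸, 2g, g, g, 0³)`), and
`ip (qvec S f a e g) (qvec S' f' a' e' g') = ip (pvec S f a e) (pvec S' f' a' e') + 6 g g'`, so every bound of
`CL17Vectors.lean` carries over with the extra term `6 g g'`. Data, counting and the transfer to `ℝ¹⁸` are in
`CL18Codes.lean`, `CL18Count.lean`, `CL18Pairs.lean`, `CL18.lean`.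

## References
* H. Cohn, A. Li, *Improved kissing numbers in seventeen through twenty-one dimensions*, arXiv:2411.04916 (2024), §4. [`CohnLi2024`]
-/

namespace Summit.Ventures.PackingBounds.Config.CL17

open Finset Leech Golay

/-! ### Additivity of `ip` -/

/-- `ip` is additive on the left. -/
theorem ip_add_left (x y z : Fin 24 → ℤ) : ip (x + y) z = ip x z + ip y z := by
  simp only [ip, Pi.add_apply, add_mul, Finset.sum_add_distrib]

/-- `ip` is additive on the right. -/
theorem ip_add_right (x y z : Fin 24 → ℤ) : ip x (y + z) = ip x y + ip x z := by
  simp only [ip, Pi.add_apply, mul_add, Finset.sum_add_distrib]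

/-! ### The second axis -/

/-- The `√6`-axis vector with coefficient `g`: `(0¹⁸, 2g, g, g, 0, 0, 0)`. -/
def axis6 (g : ℤ) : Fin 24 → ℤ :=
  fun j => (if j = 18 then 2 * g else 0) + ((if j = 19 then g else 0) + (if j = 20 then g else 0))

/-- Testing a vector against the `√6`-axis. -/
theorem ip_axis6 (x : Fin 24 → ℤ) (g : ℤ) : ip x (axis6 g) = g * (2 * x 18 + x 19 + x 20) := by
  simp only [ip, axis6, mul_add, Finset.sum_add_distrib, mul_ite, mul_zero, Finset.sum_ite_eq', Finset.mem_univ,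
    if_true]
  ring

/-- The `√6`-axis vector vanishes off the coordinates `18, 19, 20`. -/
theorem axis6_apply_of_ne {g : ℤ} {j : Fin 24} (h18 : j ≠ 18) (h19 : j ≠ 19) (h20 : j ≠ 20) : axis6 g j = 0 := by
  simp [axis6, h18, h19, h20]

/-- Values of the `√6`-axis vector on its three coordinates. -/
theorem axis6_apply_18_19_20 (g : ℤ) : axis6 g 18 = 2 * g ∧ axis6 g 19 = g ∧ axis6 g 20 = g := by
  refine ⟨?_, ?_, ?_⟩ <;> simp [axis6]

/-- A pattern vector on cells is orthogonal to the `√6`-axis. -/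
theorem ip_pvec_axis6 {S : Finset (Fin 24)} (hS : S ⊆ cells) (f : Fin 24 → Bool) (a e g : ℤ) :
    ip (pvec S f a e) (axis6 g) = 0 := by
  rw [ip_axis6, pvec_apply_ge hS f a e (j := 18) (by decide), pvec_apply_ge hS f a e (j := 19) (by decide),
    pvec_apply_ge hS f a e (j := 20) (by decide)]
  ring

/-- Two `√6`-axis vectors: `ip = 6 g g'`. -/
theorem ip_axis6_axis6 (g g' : ℤ) : ip (axis6 g) (axis6 g') = 6 * g * g' := by
  rw [ip_axis6]
  obtain ⟨h18, h19, h20⟩ := axis6_apply_18_19_20 g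
  rw [h18, h19, h20]; ring

/-! ### Pattern vectors with two axes -/

/-- **Pattern vector with two axes**: `a · sgn (f j)` on the cells `j ∈ S`, `e` on the doubled `√2`-axis
(`16, 17`), `(2g, g, g)` on the tripled `√6`-axis (`18, 19, 20`), `0` on `21, 22, 23`. [cite: CohnLi2024, §4] -/
def qvec (S : Finset (Fin 24)) (f : Fin 24 → Bool) (a e g : ℤ) : Fin 24 → ℤ := pvec S f a e + axis6 g

/-- **Inner products of two-axis pattern vectors**: the one-axis formula plus `6 g g'`. -/
theorem ip_qvec_qvec {S S' : Finset (Fin 24)} (hS : S ⊆ cells) (hS' : S' ⊆ cells) (f f' : Fin 24 → Bool)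
    (a e g a' e' g' : ℤ) :
    ip (qvec S f a e g) (qvec S' f' a' e' g') = ip (pvec S f a e) (pvec S' f' a' e') + 6 * g * g' := by
  rw [qvec, qvec, ip_add_left, ip_add_right, ip_add_right, ip_pvec_axis6 hS, ip_comm (axis6 g) (pvec S' f' a' e'),
    ip_pvec_axis6 hS', ip_axis6_axis6]
  ring

/-- **Norm**: `a² |S| + 2 e² + 6 g²`. -/
theorem ip_qvec_self {S : Finset (Fin 24)} (hS : S ⊆ cells) (f : Fin 24 → Bool) (a e g : ℤ) :
    ip (qvec S f a e g) (qvec S f a e g) = a * a * S.card + 2 * e * e + 6 * g * g := by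
  rw [ip_qvec_qvec hS hS, ip_pvec_self hS]

/-- **Intersection bound** with two axes. -/
theorem ip_qvec_qvec_le_inter {S S' : Finset (Fin 24)} (hS : S ⊆ cells) (hS' : S' ⊆ cells)
    (f f' : Fin 24 → Bool) {a a' : ℤ} (haa : 0 ≤ a * a') (e g e' g' : ℤ) :
    ip (qvec S f a e g) (qvec S' f' a' e' g') ≤ a * a' * (S ∩ S').card + 2 * e * e' + 6 * g * g' := by
  rw [ip_qvec_qvec hS hS']
  have := ip_pvec_pvec_le_inter hS hS' f f' haa e e'
  linarith

/-- **Same support, two odd patterns that differ somewhere**, with two axes. -/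
theorem ip_qvec_qvec_le_of_odd_odd {S : Finset (Fin 24)} (hS : S ⊆ cells) {f f' : Fin 24 → Bool}
    (hf : Odd (S.filter fun j => f j = true).card) (hf' : Odd (S.filter fun j => f' j = true).card)
    (hne : ∃ j ∈ S, f j ≠ f' j) {a a' : ℤ} (haa : 0 ≤ a * a') (e g e' g' : ℤ) :
    ip (qvec S f a e g) (qvec S f' a' e' g') ≤ a * a' * ((S.card : ℤ) - 4) + 2 * e * e' + 6 * g * g' := by
  rw [ip_qvec_qvec hS hS]
  have := ip_pvec_pvec_le_of_odd_odd hS hf hf' hne haa e e'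
  linarith

/-- **Odd pattern against an even one on a larger support**, with two axes. -/
theorem ip_qvec_qvec_le_of_odd_even {S S' : Finset (Fin 24)} (hSS' : S ⊆ S') (hS' : S' ⊆ cells)
    {f f' : Fin 24 → Bool} (hf : Odd (S.filter fun j => f j = true).card)
    (hf' : Even (S.filter fun j => f' j = true).card) {a a' : ℤ} (haa : 0 ≤ a * a') (e g e' g' : ℤ) :
    ip (qvec S f a e g) (qvec S' f' a' e' g') ≤ a * a' * ((S.card : ℤ) - 2) + 2 * e * e' + 6 * g * g' := by
  rw [ip_qvec_qvec (hSS'.trans hS') hS']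
  have := ip_pvec_pvec_le_of_odd_even hSS' hS' hf hf' haa e e'
  linarith

/-- **Two all-cells sign vectors** with two axes. -/
theorem ip_qvec_cells (c c' : ℕ) (a e g a' e' g' : ℤ) :
    ip (qvec cells (fun j => c.testBit j.val) a e g) (qvec cells (fun j => c'.testBit j.val) a' e' g') =
      a * a' * (16 - 2 * (wtK 16 (c ^^^ c') : ℤ)) + 2 * e * e' + 6 * g * g' := by
  rw [ip_qvec_qvec subset_rfl subset_rfl, ip_pvec_cells]

/-- A one-axis pattern vector against a two-axis one: the second axis does not contribute. -/
theorem ip_pvec_qvec {S S' : Finset (Fin 24)} (hS : S ⊆ cells) (f f' : Fin 24 → Bool) (a e a' e' g' : ℤ) :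
    ip (pvec S f a e) (qvec S' f' a' e' g') = ip (pvec S f a e) (pvec S' f' a' e') := by
  rw [qvec, ip_add_right, ip_pvec_axis6 hS]; ring

/-! ### Coordinates -/

/-- A cell is none of the `√6`-axis coordinates. -/
theorem ne_axis6_of_lt {j : Fin 24} (hj : j.val < 16) : j ≠ 18 ∧ j ≠ 19 ∧ j ≠ 20 := by
  refine ⟨?_, ?_, ?_⟩ <;> (intro h; rw [h] at hj; exact absurd hj (by decide))

/-- Value of a two-axis pattern vector on a cell. -/
theorem qvec_apply_of_lt (S : Finset (Fin 24)) (f : Fin 24 → Bool) (a e g : ℤ) {j : Fin 24} (hj : j.val < 16) :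
    qvec S f a e g j = if j ∈ S then a * sgn (f j) else 0 := by
  obtain ⟨h18, h19, h20⟩ := ne_axis6_of_lt hj
  rw [qvec, Pi.add_apply, pvec_apply_of_lt S f a e hj, axis6_apply_of_ne h18 h19 h20, add_zero]

/-- Values on the `√2`-axis. -/
theorem qvec_apply_16_17 {S : Finset (Fin 24)} (hS : S ⊆ cells) (f : Fin 24 → Bool) (a e g : ℤ) :
    qvec S f a e g 16 = e ∧ qvec S f a e g 17 = e := by
  constructor
  · rw [qvec, Pi.add_apply, pvec_apply_16 hS, axis6_apply_of_ne (by decide) (by decide) (by decide), add_zero]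
  · rw [qvec, Pi.add_apply, pvec_apply_17 hS, axis6_apply_of_ne (by decide) (by decide) (by decide), add_zero]

/-- Values on the `√6`-axis. -/
theorem qvec_apply_18_19_20 {S : Finset (Fin 24)} (hS : S ⊆ cells) (f : Fin 24 → Bool) (a e g : ℤ) :
    qvec S f a e g 18 = 2 * g ∧ qvec S f a e g 19 = g ∧ qvec S f a e g 20 = g := by
  obtain ⟨h18, h19, h20⟩ := axis6_apply_18_19_20 g
  refine ⟨?_, ?_, ?_⟩
  · rw [qvec, Pi.add_apply, pvec_apply_ge hS f a e (j := 18) (by decide), h18, zero_add]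
  · rw [qvec, Pi.add_apply, pvec_apply_ge hS f a e (j := 19) (by decide), h19, zero_add]
  · rw [qvec, Pi.add_apply, pvec_apply_ge hS f a e (j := 20) (by decide), h20, zero_add]

/-- A two-axis pattern vector vanishes on the last three coordinates. -/
theorem qvec_apply_ge {S : Finset (Fin 24)} (hS : S ⊆ cells) (f : Fin 24 → Bool) (a e g : ℤ) {j : Fin 24}
    (hj : 21 ≤ j.val) : qvec S f a e g j = 0 := by
  have h18 : j ≠ 18 := by intro h; rw [h] at hj; exact absurd hj (by decide)
  have h19 : j ≠ 19 := by intro h; rw [h] at hj; exact absurd hj (by decide)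
  have h20 : j ≠ 20 := by intro h; rw [h] at hj; exact absurd hj (by decide)
  rw [qvec, Pi.add_apply, pvec_apply_ge hS f a e (by omega), axis6_apply_of_ne h18 h19 h20, add_zero]

/-- Absolute value on a cell is `≤ |a|`. -/
theorem abs_qvec_apply_le {S : Finset (Fin 24)} (f : Fin 24 → Bool) (a e g : ℤ) {j : Fin 24} (hj : j.val < 16) :
    |qvec S f a e g j| ≤ |a| := by
  rw [qvec_apply_of_lt S f a e g hj]
  split_ifs
  · rcases sgn_cases (f j) with h | h <;> rw [h] <;> simp
  · simp

/-- Two-axis pattern vectors with the same signs on `S` and the same axis values are equal. -/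
theorem qvec_congr {S : Finset (Fin 24)} {f f' : Fin 24 → Bool} (h : ∀ j ∈ S, f j = f' j) (a e g : ℤ) :
    qvec S f a e g = qvec S f' a e g := by
  rw [qvec, qvec, pvec_congr h]

/-- Equal two-axis pattern vectors on the same support (`a ≠ 0`): same signs on the support, same axis values. -/
theorem qvec_eq_qvec {S : Finset (Fin 24)} (hS : S ⊆ cells) {f f' : Fin 24 → Bool} {a e g e' g' : ℤ} (ha : a ≠ 0)
    (h : qvec S f a e g = qvec S f' a e' g') : (∀ j ∈ S, f j = f' j) ∧ e = e' ∧ g = g' := by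
  refine ⟨fun j hj => ?_, ?_, ?_⟩
  · have hc := congrFun h j
    have hjl := mem_cells.mp (hS hj)
    rw [qvec_apply_of_lt S f a e g hjl, qvec_apply_of_lt S f' a e' g' hjl, if_pos hj, if_pos hj] at hc
    exact sgn_injective (mul_left_cancel₀ ha hc)
  · have hc := congrFun h 16
    rwa [(qvec_apply_16_17 hS f a e g).1, (qvec_apply_16_17 hS f' a e' g').1] at hc
  · have hc := congrFun h 19
    rwa [(qvec_apply_18_19_20 hS f a e g).2.1, (qvec_apply_18_19_20 hS f' a e' g').2.1] at hc

/-- The nonzero cells of a two-axis pattern vector with `a ≠ 0` form its support. -/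
theorem nz_qvec_eq {S : Finset (Fin 24)} (hS : S ⊆ cells) (f : Fin 24 → Bool) {a : ℤ} (ha : a ≠ 0) (e g : ℤ) :
    (cells.filter fun j => qvec S f a e g j ≠ 0) = S := by
  ext j
  simp only [Finset.mem_filter, mem_cells]
  constructor
  · rintro ⟨hj, hne⟩
    rw [qvec_apply_of_lt S f a e g hj] at hne
    by_contra h; exact hne (by rw [if_neg h])
  · intro hj
    have hjl := mem_cells.mp (hS hj)
    refine ⟨hjl, ?_⟩
    rw [qvec_apply_of_lt S f a e g hjl, if_pos hj]
    rcases sgn_cases (f j) with h1 | h1 <;> simp [h1, ha]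

end Summit.Ventures.PackingBounds.Config.CL17
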